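import Literature.Topology.FourManifolds.OrientedConnectedSumUniqueness
import Literature.Topology.FourManifolds.DiscTheoremCorners
import Literature.Topology.FourManifolds.ConnectedSumShape
import Literature.Topology.FourManifolds.ConnectedSumNormSmooth
import HarnessLib

/-!
# Uniqueness of the oriented connected sum up to diffeomorphism (proofs for `ConnectedSum.lean`)

Topic `Literature/Topology/FourManifolds`. This file concerns the named fact
`Literature.Topology.FourManifolds.nonempty_diffeomorph_of_isOrientedConnectedSum` of
`Literature/Topology/FourManifolds/ConnectedSum.lean` ("two oriented connected sums of the same
connected oriented manifolds `M`, `N` are diffeomorphic"; Kervaire–Milnor, *Groups of homotopy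
spheres I*, Ann. of Math. 77 (1963), §2, Lemma 2.1 "The connected sum operation is well defined …
up to orientation preserving diffeomorphism"; Kosinski, *Differential Manifolds* (1993), Ch. VI
§1, Thm (1.1) "`M₁ # M₂` … does not depend—up to diffeomorphism—on the choice of `α` and of the
imbeddings `hᵢ`"). It proves, without changing any statement of `ConnectedSum.lean`:

* `Literature.Topology.FourManifolds.nonempty_diffeomorph_of_isOrientedConnectedSum_of_exists` — the fact is the `Nonempty`
  shadow of the in-file named fact
  `Literature.Topology.FourManifolds.exists_diffeomorph_isOrientationPreserving_of_isOrientedConnectedSum` (orientation-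
  preserving uniqueness) at the same models: the one-line reduction which was the interim proof.
* `Literature.Topology.FourManifolds.nonempty_diffeomorph_of_isOrientedConnectedSum_euclidean` — **the printed theorem,
  proved**: for smooth `n`-manifolds modelled on `ℝⁿ` (`EuclideanSpace ℝ (Fin n)`, model `𝓡 n`,
  all four of `M N P P'`) any two oriented connected sums of connected oriented `M`, `N` are
  diffeomorphic; this is the instance `IM = IN = IP = IP' = 𝓡 n` of the named fact, stated as
  that instance (`Literature.Topology.FourManifolds.nonempty_diffeomorph_of_isOrientedConnectedSum_holds_euclidean`) so that a
  consumer carrying the fact as a hypothesis at Euclidean models is fed directly. The proof is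
  `Literature.Topology.FourManifolds.exists_diffeomorph_isOrientationPreserving_of_isOrientedConnectedSum_euclidean`
  (`OrientedConnectedSumUniqueness.lean`: the oriented disc theorem of Palais–Cerf, proved there
  after Hirsch, *Differential Topology* (1976), Ch. 8 §3 Thm. 3.1, and Kervaire–Milnor's
  reflection argument), forgetting that the diffeomorphism preserves orientation.
* `Literature.Topology.FourManifolds.exists_diffeomorph_isOrientationPreserving_of_isOrientedConnectedSum_holds_euclidean` —
  the same instance of the stronger named fact, in the form consumed by
  `HomotopySpheresGroupAssembly.lean` / `HomotopySpheresGroupProofs.lean` (hypothesis `hPC`).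

## Why only the Euclidean instance: the named fact is stated beyond its sources

`Literature.Topology.FourManifolds.nonempty_diffeomorph_of_isOrientedConnectedSum` quantifies over (1) an *arbitrary*
finite-dimensional real normed space `E`, whose unit sphere `{‖u‖ = 1}` enters Kervaire–Milnor's
gluing relation `i₁ (t • u) ∼ i₂ ((1 - t) • u)` (`Literature.Topology.FourManifolds.connectedSumRel`), and (2) *arbitrary*
models with corners `IM IN IP IP' : ModelWithCorners ℝ E H` (any `H`, boundary and corners
allowed). The sources state and prove the theorem for `E = ℝⁿ` with its Euclidean norm and discs
`Dⁿ ⊂ ℝⁿ` / `ℝⁿ` (Kervaire–Milnor p. 505: "for each unit vector `u ∈ Sⁿ⁻¹`"; Kosinski p. 90: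
`α_m(v) = α(|v|) v/|v|`). Two steps of the printed proof use this:

1. *Independence of the orientation convention of the model disc* (the datum `o₀` of
   `Literature.Topology.FourManifolds.IsOrientedConnectedSum` is existentially quantified, so two oriented connected sums may
   come with `o₀` and `-o₀`; this case is Kervaire–Milnor's "commutative"): Kervaire–Milnor
   compose both primed discs with a reflection `r` of `ℝⁿ`, and the relation is unchanged only
   because `r` is a *linear isometry* (`Literature.Topology.FourManifolds.connectedSumRel_symm_apply_iff`,
   `Literature.Topology.FourManifolds.exists_linearIsometryEquiv_det_eq_neg_one`). A finite-dimensional normed space need not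
   admit an orientation-reversing linear isometry (in even dimension `-1` preserves orientation,
   and a norm may have linear isometry group `{±1}`), so for general `E` the printed argument
   does not apply; an additional lemma "the connected sum does not depend on the (smooth,
   star-shaped) shape of the model disc" would be needed, which is not the cited statement.
2. *The disc theorem* (Palais 1960 Thm. B / Cerf 1961 / Kosinski III.3.6 / Hirsch 8.3.1) is
   proved in this tree for manifolds modelled on `𝓡 n` (`Literature.Topology.FourManifolds.exists_diffeomorph_apply_disc_eq`,
   with `Homogeneity.lean`, `ChartTransport.lean`); manifolds with boundary (covered by Kosinski's
   (1.1), discs in `Int M`) and models with arbitrary `H` are not available at this pin.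

Accordingly the general fact was at first *not* discharged here; the Euclidean instance below
is exactly the printed theorem, and every consumer in the tree instantiates the uniqueness facts
at `𝓡 n` (`HomotopySpheresGroupAssembly.lean`).

## The general discharge (last section)

Both missing steps have since been supplied, and the last section of this file proves the named
fact in full generality,
`Literature.Topology.FourManifolds.nonempty_diffeomorph_of_isOrientedConnectedSum_holds`:

1. the **shape lemma** `nonempty_diffeomorph_of_isOpenGluing_shape` (`ConnectedSumShape.lean`):
   the gluings along the unit disc of the norm and along the unit disc `{‖T v‖ < 1}` of a
   norm-non-decreasing linear automorphism `T` of `E` (same discs) are diffeomorphic — this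
   replaces Kervaire–Milnor's isometric reflection by an arbitrary linear reflection `r`
   rescaled to operator norm `≤ 1` (`T = r⁻¹`); the smoothness of the norm away from `0` that it
   needs is forced by the very existence of a gluing along `connectedSumRel`
   (`contDiffOn_norm_of_isOpenGluing_connectedSumRel`, `ConnectedSumNormSmooth.lean`);
2. the **disc theorem for arbitrary models with corners**
   `exists_diffeomorph_apply_disc_eq_of_model` (`DiscTheoremCorners.lean`): interior manifold,
   recharting on `ℝⁿ`, the tree's oriented disc theorem with compact support, extension by the
   identity.

## References

* M. Kervaire, J. Milnor, *Groups of homotopy spheres I*, Ann. of Math. 77 (1963) 504–537, §2,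
  Lemma 2.1 (p. 505). [KervaireMilnorAnnals1963]
* A. Kosinski, *Differential Manifolds*, Academic Press (1993), Ch. VI §1, Thm (1.1) (p. 90–91).
  [Kosinski1993]
* R. Palais, *Extending diffeomorphisms*, Proc. AMS 11 (1960) 274–277, Thm. B. [Palais1960]
* M. W. Hirsch, *Differential Topology*, GTM 33 (1976), Ch. 8 §3, Thm. 3.1. [HirschDT1976]
-/

open scoped Manifold ContDiff Topology
open Set Module

noncomputable section

namespace Literature.Topology.FourManifolds

/-! ### The reduction to orientation-preserving uniqueness (all models) -/

section General

variable {E HM HN HP HP' : Type*} [NormedAddCommGroup E] [NormedSpace ℝ E]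
  [TopologicalSpace HM] {IM : ModelWithCorners ℝ E HM}
  [TopologicalSpace HN] {IN : ModelWithCorners ℝ E HN}
  [TopologicalSpace HP] {IP : ModelWithCorners ℝ E HP}
  [TopologicalSpace HP'] {IP' : ModelWithCorners ℝ E HP'}
  {M N P P' : Type*} [TopologicalSpace M] [T2Space M] [ChartedSpace HM M] [IsManifold IM ∞ M]
  [TopologicalSpace N] [T2Space N] [ChartedSpace HN N] [IsManifold IN ∞ N]
  [TopologicalSpace P] [ChartedSpace HP P] [IsManifold IP ∞ P]
  [TopologicalSpace P'] [ChartedSpace HP' P'] [IsManifold IP' ∞ P']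

/-- **Uniqueness up to diffeomorphism from oriented uniqueness** (Kervaire–Milnor, *Groups of
homotopy spheres I* (1963), Lemma 2.1; Kosinski, *Differential Manifolds* (1993), VI.(1.1)): at
any models `IM IN IP IP'`, the named fact `nonempty_diffeomorph_of_isOrientedConnectedSum`
("two oriented connected sums of connected oriented `M`, `N` are diffeomorphic") follows from the
named fact `exists_diffeomorph_isOrientationPreserving_of_isOrientedConnectedSum` ("… by an
orientation-preserving diffeomorphism") by forgetting the orientation condition. This is the
interim proof recorded in `ConnectedSum.lean`.
[cite: KervaireMilnorAnnals1963, §2, Lemma 2.1 (p. 505)] -/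
theorem nonempty_diffeomorph_of_isOrientedConnectedSum_of_exists
    (hU : exists_diffeomorph_isOrientationPreserving_of_isOrientedConnectedSum (IM := IM) (IN := IN)
      (IP := IP) (IP' := IP') (M := M) (N := N) (P := P) (P' := P')) :
    nonempty_diffeomorph_of_isOrientedConnectedSum (IM := IM) (IN := IN) (IP := IP) (IP' := IP')
      (M := M) (N := N) (P := P) (P' := P') := by
  intro _ _ _ _ oM oN oP oP' h h'
  obtain ⟨e, -⟩ := hU h h'
  exact ⟨e⟩

end General

/-! ### The printed theorem: Euclidean models -/

section Euclidean

variable {n : ℕ}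

variable {M N P P' : Type*}
  [TopologicalSpace M] [T2Space M] [ChartedSpace (EuclideanSpace ℝ (Fin n)) M]
  [IsManifold (𝓡 n) ∞ M]
  [TopologicalSpace N] [T2Space N] [ChartedSpace (EuclideanSpace ℝ (Fin n)) N]
  [IsManifold (𝓡 n) ∞ N]
  [TopologicalSpace P] [ChartedSpace (EuclideanSpace ℝ (Fin n)) P] [IsManifold (𝓡 n) ∞ P]
  [TopologicalSpace P'] [ChartedSpace (EuclideanSpace ℝ (Fin n)) P'] [IsManifold (𝓡 n) ∞ P']

/-- **Uniqueness of the connected sum up to diffeomorphism, Euclidean models** (Kervaire–Milnor,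
*Groups of homotopy spheres I*, Ann. of Math. 77 (1963), §2, Lemma 2.1: "The connected sum
operation is well defined … up to orientation preserving diffeomorphism", discs `Dⁿ ⊂ ℝⁿ`,
`i₁` orientation preserving, `i₂` reversing, `i₁ (t u) ∼ i₂ ((1 - t) u)` for unit vectors
`u ∈ Sⁿ⁻¹`, `0 < t < 1`; Kosinski, *Differential Manifolds* (1993), Ch. VI §1, Thm (1.1): "It does
not depend—up to diffeomorphism—on the choice … of the imbeddings `hᵢ`"): if `(P, oP)` and
`(P', oP')` are oriented connected sums (`Literature.Topology.FourManifolds.IsOrientedConnectedSum`) of the connected oriented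
Hausdorff smooth `n`-manifolds `(M, oM)`, `(N, oN)` modelled on `ℝⁿ`, then `P` and `P'` are
diffeomorphic. Proof:
`exists_diffeomorph_isOrientationPreserving_of_isOrientedConnectedSum_euclidean`
(oriented disc theorem of Palais–Cerf + Kervaire–Milnor's reflection argument, proved in
`OrientedConnectedSumUniqueness.lean`), forgetting the orientation of the diffeomorphism. No
compactness or second countability is needed.
[cite: KervaireMilnorAnnals1963, §2, Lemma 2.1 (p. 505)]
[cite: Kosinski1993, Ch. VI §1, Thm (1.1)] -/
theorem nonempty_diffeomorph_of_isOrientedConnectedSum_euclidean [ConnectedSpace M]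
    [ConnectedSpace N] {oM : SmoothOrientation (𝓡 n) M} {oN : SmoothOrientation (𝓡 n) N}
    {oP : SmoothOrientation (𝓡 n) P} {oP' : SmoothOrientation (𝓡 n) P'}
    (h : IsOrientedConnectedSum oM oN oP) (h' : IsOrientedConnectedSum oM oN oP') :
    Nonempty (P ≃ₘ⟮𝓡 n, 𝓡 n⟯ P') := by
  obtain ⟨e, -⟩ :=
    exists_diffeomorph_isOrientationPreserving_of_isOrientedConnectedSum_euclidean h h'
  exact ⟨e⟩

/-- **The named fact `nonempty_diffeomorph_of_isOrientedConnectedSum` holds at Euclidean models**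
(`IM = IN = IP = IP' = 𝓡 n`, the generality of the printed theorem: Kervaire–Milnor (1963),
Lemma 2.1; Kosinski (1993), VI.(1.1)). This is the instance of the fact which consumers carrying
it as a hypothesis `(h : nonempty_diffeomorph_of_isOrientedConnectedSum (IM := 𝓡 n) …)` are fed.
The fact itself is stated for an arbitrary finite-dimensional normed model space `E` (whose unit
sphere enters the gluing relation) and arbitrary models with corners; in that generality the
printed proof does not apply (Kervaire–Milnor's reflection must be a linear isometry of `E`, and
the disc theorem is available in this tree for `𝓡 n`-manifolds only) — see the module docstring.
[cite: KervaireMilnorAnnals1963, §2, Lemma 2.1 (p. 505)]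
[cite: Kosinski1993, Ch. VI §1, Thm (1.1)] -/
theorem nonempty_diffeomorph_of_isOrientedConnectedSum_holds_euclidean :
    nonempty_diffeomorph_of_isOrientedConnectedSum (IM := 𝓡 n) (IN := 𝓡 n) (IP := 𝓡 n)
      (IP' := 𝓡 n) (M := M) (N := N) (P := P) (P' := P') := by
  intro _ _ _ _ oM oN oP oP' h h'
  exact nonempty_diffeomorph_of_isOrientedConnectedSum_euclidean h h'

/-- **The named fact `exists_diffeomorph_isOrientationPreserving_of_isOrientedConnectedSum` holds
at Euclidean models** (`IM = IN = IP = IP' = 𝓡 n`): Kervaire–Milnor (1963), Lemma 2.1, "well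
defined … up to orientation preserving diffeomorphism", in the instance form consumed as the
hypothesis `hPC` of `Literature.Topology.FourManifolds.HomotopySphereClass.groupLawFacts_of_remainingFacts` and
`Literature.Topology.FourManifolds.exists_commGroup_homotopySphereClass_of_remainingFacts`; the proof is
`exists_diffeomorph_isOrientationPreserving_of_isOrientedConnectedSum_euclidean`
(`OrientedConnectedSumUniqueness.lean`). [cite: KervaireMilnorAnnals1963, §2, Lemma 2.1 (p. 505)] -/
theorem exists_diffeomorph_isOrientationPreserving_of_isOrientedConnectedSum_holds_euclidean :
    exists_diffeomorph_isOrientationPreserving_of_isOrientedConnectedSum (IM := 𝓡 n) (IN := 𝓡 n)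
      (IP := 𝓡 n) (IP' := 𝓡 n) (M := M) (N := N) (P := P) (P' := P') := by
  intro _ _ _ _ oM oN oP oP' h h'
  exact exists_diffeomorph_isOrientationPreserving_of_isOrientedConnectedSum_euclidean h h'

end Euclidean


/-! ### The general discharge: arbitrary `E` and arbitrary models with corners -/

section GeneralDischarge

open ShapeRadial

variable {E : Type*} [NormedAddCommGroup E] [NormedSpace ℝ E] [FiniteDimensional ℝ E]

/-! #### Linear preliminaries -/

omit [FiniteDimensional ℝ E] in
/-- In a manifold whose model vector space is `0`-dimensional, points are open (each chart is
injective into a one-point model). [folklore] -/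
theorem isOpen_singleton_of_subsingleton_model [Subsingleton E] {H : Type*} [TopologicalSpace H]
    (I : ModelWithCorners ℝ E H) {M : Type*} [TopologicalSpace M] [ChartedSpace H M] (x : M) :
    IsOpen ({x} : Set M) := by
  have h : (chartAt H x).source = {x} := by
    refine Subset.antisymm (fun q hq => (chartAt H x).injOn hq (mem_chart_source _ x) ?_) ?_
    · exact I.injective (Subsingleton.elim _ _)
    · rw [singleton_subset_iff]; exact mem_chart_source _ x
  exact h ▸ (chartAt H x).open_source

/-- A finite-dimensional real normed space of positive dimension admits a **linear automorphism
of negative determinant which does not increase norms** (a reflection of `ℝⁿ` transported along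
a linear isomorphism `E ≅ ℝⁿ`, then rescaled by `ContinuousLinearEquiv.shrink`). [folklore] -/
theorem exists_continuousLinearEquiv_det_neg_norm_le (hE : finrank ℝ E ≠ 0) :
    ∃ r : E ≃L[ℝ] E, LinearMap.det (r.toLinearEquiv : E →ₗ[ℝ] E) < 0 ∧ ∀ v, ‖r v‖ ≤ ‖v‖ := by
  set n := finrank ℝ E with hn
  obtain ⟨rE, hrE⟩ := exists_linearIsometryEquiv_det_eq_neg_one (n := n) hE
  set L₀ : E ≃L[ℝ] EuclideanSpace ℝ (Fin n) := ContinuousLinearEquiv.ofFinrankEq (by simp [hn])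
    with hL₀
  set r₀ : E ≃L[ℝ] E := L₀.trans (rE.toContinuousLinearEquiv.trans L₀.symm) with hr₀
  have hdet₀ : LinearMap.det (r₀.toLinearEquiv : E →ₗ[ℝ] E) = -1 := by
    have : (r₀.toLinearEquiv : E →ₗ[ℝ] E) =
        (L₀.symm.toLinearEquiv : EuclideanSpace ℝ (Fin n) →ₗ[ℝ] E) ∘ₗ
          (rE.toLinearEquiv : EuclideanSpace ℝ (Fin n) →ₗ[ℝ] EuclideanSpace ℝ (Fin n)) ∘ₗ
          (L₀.symm.toLinearEquiv.symm : E →ₗ[ℝ] EuclideanSpace ℝ (Fin n)) := by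
      ext v; rfl
    rw [this, LinearMap.det_conj, hrE]
  have hlin : ((ContinuousLinearEquiv.shrink r₀).toLinearEquiv : E →ₗ[ℝ] E) =
      (‖(r₀ : E →L[ℝ] E)‖ + 1)⁻¹ • (r₀.toLinearEquiv : E →ₗ[ℝ] E) := by
    ext v
    exact ContinuousLinearEquiv.shrink_apply r₀ v
  refine ⟨ContinuousLinearEquiv.shrink r₀, ?_, ContinuousLinearEquiv.norm_shrink_le r₀⟩
  rw [hlin, LinearMap.det_smul, hdet₀, mul_neg_one, neg_lt_zero]
  positivity

/-! #### Orientation bookkeeping for reflected discs -/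

section Reflect

variable {HM : Type*} [TopologicalSpace HM] {IM : ModelWithCorners ℝ E HM}
  {M : Type*} [TopologicalSpace M] [ChartedSpace HM M] [IsManifold IM ∞ M]

omit [FiniteDimensional ℝ E] in
/-- A linear automorphism of negative determinant is orientation preserving from `(E, o₀)` to
`(E, -o₀)`: its differential is itself, and `-o₀ ≠ o₀`. [folklore] -/
theorem isOrientationPreserving_linear_neg_of_det_neg (o₀ : Orientation ℝ E (Fin (finrank ℝ E)))
    (r : E ≃L[ℝ] E) (hr : LinearMap.det (r.toLinearEquiv : E →ₗ[ℝ] E) < 0) :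
    IsOrientationPreserving (SmoothOrientation.modelSpace o₀) (SmoothOrientation.modelSpace (-o₀))
      r := by
  intro y
  have hm : mfderiv 𝓘(ℝ, E) 𝓘(ℝ, E) r y = (r : E →L[ℝ] E) := r.hasFDerivAt.hasMFDerivAt.mfderiv
  have hdet : ¬ 0 < LinearMap.det (M := E) (mfderiv 𝓘(ℝ, E) 𝓘(ℝ, E) r y).toLinearMap := by
    rw [hm]; exact not_lt.2 hr.le
  simp only [SmoothOrientation.modelSpace_apply]
  exact iff_of_false (fun h => Module.Ray.ne_neg_self o₀ h.symm) hdet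

/-- **Reflecting a disc which preserves `(-o₀, oM)` gives a disc which preserves `(o₀, oM)`**,
for any linear automorphism `r` of negative determinant (general-`E`, general-model version of
`isOrientationPreserving_disc_comp_of_neg`). [folklore] -/
theorem isOrientationPreserving_disc_comp_linear_of_det_neg {i : E → M}
    (hi : Manifold.IsSmoothEmbedding 𝓘(ℝ, E) IM ∞ i) {o₀ : Orientation ℝ E (Fin (finrank ℝ E))}
    {oM : SmoothOrientation IM M}
    (ho : IsOrientationPreserving (SmoothOrientation.modelSpace (-o₀)) oM i) (r : E ≃L[ℝ] E)
    (hr : LinearMap.det (r.toLinearEquiv : E →ₗ[ℝ] E) < 0) :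
    IsOrientationPreserving (SmoothOrientation.modelSpace o₀) oM (i ∘ r) := by
  have hinf : (∞ : ℕ∞ω) ≠ 0 := by simp
  refine IsOrientationPreserving.comp_holds ho
    (isOrientationPreserving_linear_neg_of_det_neg o₀ r hr) (hi.contMDiff.mdifferentiable hinf)
    ((r : E →L[ℝ] E).contMDiff.mdifferentiable hinf)
    (fun y => det_mfderiv_ne_zero_of_isSmoothEmbedding hi (isOpenMap_disc hi).isOpen_range y)
    fun y => ?_
  have hm : mfderiv 𝓘(ℝ, E) 𝓘(ℝ, E) r y = (r : E →L[ℝ] E) := r.hasFDerivAt.hasMFDerivAt.mfderiv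
  have hdet : LinearMap.det (M := E) (mfderiv 𝓘(ℝ, E) 𝓘(ℝ, E) r y).toLinearMap ≠ 0 := by
    rw [hm]; exact hr.ne
  exact hdet

/-- Reflecting a disc which reverses `(-o₀, oN)` gives a disc which reverses `(o₀, oN)`.
[folklore] -/
theorem isOrientationReversing_disc_comp_linear_of_det_neg {i : E → M}
    (hi : Manifold.IsSmoothEmbedding 𝓘(ℝ, E) IM ∞ i) {o₀ : Orientation ℝ E (Fin (finrank ℝ E))}
    {oM : SmoothOrientation IM M}
    (ho : IsOrientationReversing (SmoothOrientation.modelSpace (-o₀)) oM i) (r : E ≃L[ℝ] E)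
    (hr : LinearMap.det (r.toLinearEquiv : E →ₗ[ℝ] E) < 0) :
    IsOrientationReversing (SmoothOrientation.modelSpace o₀) oM (i ∘ r) := by
  rw [isOrientationReversing_iff] at ho ⊢
  exact isOrientationPreserving_disc_comp_linear_of_det_neg hi ho r hr

end Reflect

/-! #### Transport of the gluing data along the disc-theorem diffeomorphisms -/

section Transport

variable {HM HN HP : Type*} [TopologicalSpace HM] [TopologicalSpace HN] [TopologicalSpace HP]
  {IM : ModelWithCorners ℝ E HM} {IN : ModelWithCorners ℝ E HN} {IP : ModelWithCorners ℝ E HP}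
  {M N P : Type*} [TopologicalSpace M] [T2Space M] [ChartedSpace HM M] [IsManifold IM ∞ M]
  [TopologicalSpace N] [T2Space N] [ChartedSpace HN N] [IsManifold IN ∞ N]
  [TopologicalSpace P] [ChartedSpace HP P] [IsManifold IP ∞ P]

omit [FiniteDimensional ℝ E] [IsManifold IP ∞ P] in
/-- **Transport of Kervaire–Milnor gluing data along diffeomorphisms of the summands.** If `P`
is an open gluing of `M ∖ i₁(0)`, `N ∖ i₂(0)` along `connectedSumRel i₁ i₂`, and `f ∈ Diff(M)`,
`g ∈ Diff(N)` satisfy `f (i₁ y) = i₁' (r y)`, `g (i₂ y) = i₂' (r y)` on the closed unit ball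
(`r` a linear automorphism of `E`), then `P` is an open gluing of `M ∖ i₁'(0)`, `N ∖ i₂'(0)`
(through `jA ∘ f⁻¹`, `jB ∘ g⁻¹`) along the `r⁻¹`-disc relation `tDiscRel r.symm i₁' i₂'`.
(Kervaire–Milnor (1963), proof of Lemma 2.1.) [cite: KervaireMilnorAnnals1963, §2, Lemma 2.1 (p. 505)] -/
theorem isOpenGluing_tDiscRel_of_apply_disc_eq {i₁ i₁' : E → M} {i₂ i₂' : E → N}
    (hG : IsOpenGluing IM IN IP (A := puncture i₁) (B := puncture i₂) (P := P)
      (connectedSumRel i₁ i₂))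
    (f : M ≃ₘ⟮IM, IM⟯ M) (g : N ≃ₘ⟮IN, IN⟯ N) (r : E ≃L[ℝ] E)
    (hf : ∀ y : E, ‖y‖ ≤ 1 → f (i₁ y) = i₁' (r y)) (hg : ∀ y : E, ‖y‖ ≤ 1 → g (i₂ y) = i₂' (r y)) :
    IsOpenGluing IM IN IP (A := puncture i₁') (B := puncture i₂') (P := P)
      (tDiscRel r.symm i₁' i₂') := by
  obtain ⟨jA, jB, hA, hAo, hB, hBo, hU, hR⟩ := hG
  have hf0 : f (i₁ 0) = i₁' 0 := by simpa using hf 0 (by simp)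
  have hg0 : g (i₂ 0) = i₂' 0 := by simpa using hg 0 (by simp)
  have keyf : ∀ (a : M) (m : M), f.symm a = m ↔ a = f m := fun a m => by
    constructor
    · rintro rfl; exact (f.apply_symm_apply a).symm
    · rintro rfl; exact f.symm_apply_apply m
  have keyg : ∀ (b : N) (m : N), g.symm b = m ↔ b = g m := fun b m => by
    constructor
    · rintro rfl; exact (g.apply_symm_apply b).symm
    · rintro rfl; exact g.symm_apply_apply m
  obtain ⟨ψM, hψM⟩ := exists_diffeomorph_opens f.symm (puncture i₁') (puncture i₁) fun a => by
    rw [mem_puncture, mem_puncture, Ne, keyf, hf0]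
  obtain ⟨ψN, hψN⟩ := exists_diffeomorph_opens g.symm (puncture i₂') (puncture i₂) fun b => by
    rw [mem_puncture, mem_puncture, Ne, keyg, hg0]
  have hψMs : Function.Surjective ψM := ψM.surjective
  have hψNs : Function.Surjective ψN := ψN.surjective
  have hnorm : ∀ (u : E) (t : ℝ), ‖u‖ = 1 → t ∈ Ioo (0 : ℝ) 1 →
      ‖t • u‖ ≤ 1 ∧ ‖(1 - t) • u‖ ≤ 1 := fun u t hu ht => by
    constructor
    · rw [norm_smul, Real.norm_of_nonneg ht.1.le, hu, mul_one]; exact ht.2.le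
    · rw [norm_smul, Real.norm_of_nonneg (by linarith [ht.2]), hu, mul_one]; linarith [ht.1]
  refine ⟨jA ∘ ψM, jB ∘ ψN, hA.comp_diffeomorph ψM, ?_, hB.comp_diffeomorph ψN, ?_, ?_,
    fun a b => ?_⟩
  · rw [hψMs.range_comp]; exact hAo
  · rw [hψNs.range_comp]; exact hBo
  · rw [hψMs.range_comp, hψNs.range_comp]; exact hU
  · rw [Function.comp_apply, Function.comp_apply, hR (ψM a) (ψN b)]
    simp only [connectedSumRel, tDiscRel, hψM, hψN, keyf, keyg,
      ContinuousLinearEquiv.symm_symm]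
    constructor
    · rintro ⟨u, t, hu, ht, ha, hb⟩
      obtain ⟨h1, h2⟩ := hnorm u t hu ht
      exact ⟨u, t, hu, ht, by rw [ha, hf _ h1], by rw [hb, hg _ h2]⟩
    · rintro ⟨u, t, hu, ht, ha, hb⟩
      obtain ⟨h1, h2⟩ := hnorm u t hu ht
      exact ⟨u, t, hu, ht, by rw [hf _ h1]; exact ha, by rw [hg _ h2]; exact hb⟩

end Transport

/-! #### The named fact, in full generality -/

section Holds

variable {HM HN HP HP' : Type*}
  [TopologicalSpace HM] {IM : ModelWithCorners ℝ E HM}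
  [TopologicalSpace HN] {IN : ModelWithCorners ℝ E HN}
  [TopologicalSpace HP] {IP : ModelWithCorners ℝ E HP}
  [TopologicalSpace HP'] {IP' : ModelWithCorners ℝ E HP'}
  {M N P P' : Type*} [TopologicalSpace M] [T2Space M] [ChartedSpace HM M] [IsManifold IM ∞ M]
  [TopologicalSpace N] [T2Space N] [ChartedSpace HN N] [IsManifold IN ∞ N]
  [TopologicalSpace P] [ChartedSpace HP P] [IsManifold IP ∞ P]
  [TopologicalSpace P'] [ChartedSpace HP' P'] [IsManifold IP' ∞ P']

/-- **Uniqueness of the oriented connected sum up to diffeomorphism, arbitrary `E` and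
arbitrary models with corners** (Kervaire–Milnor, *Groups of homotopy spheres I* (1963), §2,
Lemma 2.1; Kosinski, *Differential Manifolds* (1993), VI.(1.1)): any two oriented connected sums
`P`, `P'` of connected oriented Hausdorff second-countable `M`, `N` are diffeomorphic. Proof:
in dimension `0` both are empty; otherwise the norm of `E` is smooth away from `0`
(`contDiffOn_norm_of_isOpenGluing_connectedSumRel`); a linear automorphism `r` of `E` with
`‖r v‖ ≤ ‖v‖` — the identity if the two model-disc orientations agree, a rescaled reflection
(`det r < 0`) if they differ — makes `i₁' ∘ r` preserve and `i₂' ∘ r` reverse `(o₀, ·)`; the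
disc theorem for arbitrary models (`exists_diffeomorph_apply_disc_eq_of_model`) gives
`f ∈ Diff(M)`, `g ∈ Diff(N)` with `f ∘ i₁ = i₁' ∘ r`, `g ∘ i₂ = i₂' ∘ r` on the unit ball, so
that `P` is an open gluing of `M ∖ i₁'(0)`, `N ∖ i₂'(0)` along the `r⁻¹`-disc relation
(`isOpenGluing_tDiscRel_of_apply_disc_eq`) while `P'` is one along the norm-disc relation; the
shape lemma (`nonempty_diffeomorph_of_isOpenGluing_shape`, with `T = r⁻¹` norm-non-decreasing)
gives `P' ≅ P`. [cite: KervaireMilnorAnnals1963, §2, Lemma 2.1 (p. 505)]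
[cite: Kosinski1993, Ch. VI §1, Thm (1.1)] -/
theorem nonempty_diffeomorph_of_isOrientedConnectedSum_general [ConnectedSpace M]
    [ConnectedSpace N] {oM : SmoothOrientation IM M} {oN : SmoothOrientation IN N}
    {oP : SmoothOrientation IP P} {oP' : SmoothOrientation IP' P'}
    (h : IsOrientedConnectedSum oM oN oP) (h' : IsOrientedConnectedSum oM oN oP') :
    Nonempty (P ≃ₘ⟮IP, IP'⟯ P') := by
  obtain ⟨i₁, i₂, o₀, jA, jB, hi₁, hi₂, ho₁, ho₂, hG, -, -⟩ := h
  obtain ⟨i₁', i₂', o₀', jA', jB', hi₁', hi₂', ho₁', ho₂', hG', -, -⟩ := h'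
  -- dimension `0`: `M`, `N` are points, the pieces and `P`, `P'` are empty
  rcases eq_or_ne (finrank ℝ E) 0 with hn | hn
  · haveI : Subsingleton E := Module.finrank_zero_iff.1 hn
    obtain ⟨-, -, -, -, hU, -⟩ := hG
    obtain ⟨-, -, -, -, hU', -⟩ := hG'
    have hptM : ∀ (x a : M), a = x := fun x a => by
      have hclopen : IsClopen ({x} : Set M) :=
        ⟨isClosed_singleton, isOpen_singleton_of_subsingleton_model IM x⟩
      have h1 := hclopen.eq_univ (singleton_nonempty _)
      exact mem_singleton_iff.1 (h1.symm ▸ mem_univ a)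
    have hptN : ∀ (x a : N), a = x := fun x a => by
      have hclopen : IsClopen ({x} : Set N) :=
        ⟨isClosed_singleton, isOpen_singleton_of_subsingleton_model IN x⟩
      have h1 := hclopen.eq_univ (singleton_nonempty _)
      exact mem_singleton_iff.1 (h1.symm ▸ mem_univ a)
    haveI : IsEmpty ↥(puncture i₁) := ⟨fun a => a.2 (mem_singleton_iff.2 (hptM (i₁ 0) a))⟩
    haveI : IsEmpty ↥(puncture i₂) := ⟨fun b => b.2 (mem_singleton_iff.2 (hptN (i₂ 0) b))⟩
    haveI : IsEmpty ↥(puncture i₁') := ⟨fun a => a.2 (mem_singleton_iff.2 (hptM (i₁' 0) a))⟩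
    haveI : IsEmpty ↥(puncture i₂') := ⟨fun b => b.2 (mem_singleton_iff.2 (hptN (i₂' 0) b))⟩
    haveI : IsEmpty P := ⟨fun p => by
      rcases eq_univ_iff_forall.1 hU p with ⟨a, -⟩ | ⟨b, -⟩
      · exact isEmptyElim a
      · exact isEmptyElim b⟩
    haveI : IsEmpty P' := ⟨fun p => by
      rcases eq_univ_iff_forall.1 hU' p with ⟨a, -⟩ | ⟨b, -⟩
      · exact isEmptyElim a
      · exact isEmptyElim b⟩
    exact ⟨⟨Equiv.equivOfIsEmpty P P', fun p => isEmptyElim p, fun p => isEmptyElim p⟩⟩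
  -- positive dimension
  haveI : Nontrivial E := Module.nontrivial_of_finrank_pos (R := ℝ) (Nat.pos_of_ne_zero hn)
  -- the norm is smooth away from `0`
  have hN : ContDiffOn ℝ ∞ (fun v : E => ‖v‖) {0}ᶜ :=
    contDiffOn_norm_of_isOpenGluing_connectedSumRel hi₁ hi₂ ⟨jA, jB, hG⟩
  -- a common norm-non-increasing linear automorphism aligning the disc orientations
  obtain ⟨r, hr, hr₁, hr₂⟩ : ∃ r : E ≃L[ℝ] E, (∀ v, ‖r v‖ ≤ ‖v‖) ∧
      IsOrientationPreserving (SmoothOrientation.modelSpace o₀) oM (i₁' ∘ r) ∧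
      IsOrientationReversing (SmoothOrientation.modelSpace o₀) oN (i₂' ∘ r) := by
    rcases Orientation.eq_or_eq_neg o₀' o₀ (Fintype.card_fin _) with rfl | rfl
    · refine ⟨ContinuousLinearEquiv.refl ℝ E, fun v => le_rfl, ?_, ?_⟩
      · simpa using ho₁'
      · simpa using ho₂'
    · obtain ⟨r, hdet, hle⟩ := exists_continuousLinearEquiv_det_neg_norm_le (E := E) hn
      exact ⟨r, hle, isOrientationPreserving_disc_comp_linear_of_det_neg hi₁' ho₁' r hdet,
        isOrientationReversing_disc_comp_linear_of_det_neg hi₂' ho₂' r hdet⟩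
  have hi₁r : Manifold.IsSmoothEmbedding 𝓘(ℝ, E) IM ∞ (i₁' ∘ r) :=
    hi₁'.comp_diffeomorph r.toDiffeomorph
  have hi₂r : Manifold.IsSmoothEmbedding 𝓘(ℝ, E) IN ∞ (i₂' ∘ r) :=
    hi₂'.comp_diffeomorph r.toDiffeomorph
  -- the disc theorem in `M` and in `N` (for `N` with the orientation `-oN`)
  obtain ⟨f, hf⟩ := exists_diffeomorph_apply_disc_eq_of_model hn hi₁ hi₁r ho₁ hr₁
  obtain ⟨g, hg⟩ := exists_diffeomorph_apply_disc_eq_of_model (oM := -oN) hn hi₂ hi₂r ho₂ hr₂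
  -- `P` is glued along the `r⁻¹`-disc relation for the primed discs, `P'` along the norm relation
  have hGt : IsOpenGluing IM IN IP (A := puncture i₁') (B := puncture i₂') (P := P)
      (tDiscRel r.symm i₁' i₂') :=
    isOpenGluing_tDiscRel_of_apply_disc_eq ⟨jA, jB, hG⟩ f g r hf hg
  have hT : ∀ v : E, ‖v‖ ≤ ‖r.symm v‖ := fun v => by
    simpa using hr (r.symm v)
  obtain ⟨Ψ⟩ := nonempty_diffeomorph_of_isOpenGluing_shape (IP := IP') (IP' := IP) hN r.symm hT
    hi₁' hi₂' ⟨jA', jB', hG'⟩ hGt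
  exact ⟨Ψ.symm⟩

/-- **The named fact `nonempty_diffeomorph_of_isOrientedConnectedSum` holds** — in the full
generality in which `ConnectedSum.lean` states it: arbitrary finite-dimensional real normed model
vector space `E`, arbitrary models with corners `IM IN IP IP'` (Kervaire–Milnor (1963),
Lemma 2.1; Kosinski (1993), VI.(1.1); see `nonempty_diffeomorph_of_isOrientedConnectedSum_general`
and the module docstring for the two extra lemmas — shape independence and the disc theorem for
arbitrary models — that the general statement requires beyond the printed proofs).
[cite: KervaireMilnorAnnals1963, §2, Lemma 2.1 (p. 505)] [cite: Kosinski1993, Ch. VI §1, Thm (1.1)] -/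
theorem nonempty_diffeomorph_of_isOrientedConnectedSum_holds :
    nonempty_diffeomorph_of_isOrientedConnectedSum (IM := IM) (IN := IN) (IP := IP) (IP' := IP')
      (M := M) (N := N) (P := P) (P' := P') := by
  intro _ _ _ _ oM oN oP oP' h h'
  exact nonempty_diffeomorph_of_isOrientedConnectedSum_general h h'

end Holds

end GeneralDischarge

end Literature.Topology.FourManifolds
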